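import Literature.Analysis.Complex.SchottkyQuantitative
import Literature.Analysis.Complex.OmittedValuesGrowth
import HarnessLib

/-!
# Uniform mean growth of disc maps omitting the `N`-th roots of unity — CDT Theorem 6.0.1, unconditional

`Literature/Analysis/Complex/OmittedRootsOfUnityMeanGrowth.lean` — PROOF-ONLY (no definition, no
named fact).

F. Calegari, V. Dimitrov, Y. Tang, *The unbounded denominators conjecture*, J. Amer. Math. Soc. 38
(2025) 627–702 (arXiv:2109.09040), **Theorem 6.0.1** (the "growth term" of the dimension bound of
their Proposition 3.0.1 = arXiv Proposition 15, hypothesis `(mean)`): for the universal covering map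
`F_N : D(0,1) → ℂ ∖ μ_N`, `F_N(0) = 0`, and fixed `B > 0`,
`∫_{|z| = 1 − B N⁻³} log⁺|F_N| μ_Haar ≪_B (log N)/N`.

The tree's `Literature.Analysis.Complex.uniform_growth_of_omitting_rootsOfUnity` (file
`OmittedValuesGrowth.lean`) is CDT's display (6.12) with explicit constants, CONDITIONAL on a bound
`M` for `log⁺ log⁺ |F|` on the circle `|z| = (1 + r)/2` — in the printed proof this is their
Lemma 5.3.5 (`trivialsupFN`), obtained from the hyperbolic geometry of the Fuchsian group `Γ_N`
(op. cit. §5.2). Here that input is replaced by SCHOTTKY'S THEOREM with a polynomial rate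
(`exists_log_norm_le_of_mapsTo_compl_zero_one_of_isCompact`, file `SchottkyQuantitative.lean`): the
map `g = (F − 1)/(b − 1)`, `b ∈ μ_N` with `Re b ≤ −1/2`, omits `0` and `1` and has
`g(0) = 1/(1 − b)` in the fixed compact disc `|u − 1/2| ≤ 1/3`, so `log |g(z)| ≤ C/(1 − |z|)ⁿ` with
ABSOLUTE `C, n`, whence `M = O(1) + n log(1/(1 − r))`. Results (all sorry-free):

* `exists_pow_eq_one_re_le` — for `N ≥ 2` some `N`-th root of unity has real part `≤ −1/2`;
* `exists_uniform_mean_growth_of_omitting_rootsOfUnity` — **(6.12) unconditionally**: absolute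
  `C₁, C₂` with `(N − 1)·m(r, F) ≤ C₁ log(1/(1 − r)) + log N + C₂` for EVERY `N ≥ 2`, `0 < r < 1`
  and every `F` holomorphic on the unit disc with `F(0) = 0`, `|F′(0)| ≥ 1`, `F′` zero-free and `F`
  omitting `μ_N` (`m(r, F) = ∫_{|z|=r} log⁺|F| μ_Haar`);
* ★ `exists_circleAverage_posLog_le_of_omitting_rootsOfUnity` — **CDT Theorem 6.0.1** in the
  printed shape: for every `B > 0` there is `C_B` with `m(1 − B/N³, F) ≤ C_B (log N)/N` for all
  `N ≥ 2` with `N³ > B` and all such `F` — in particular for the universal covering map `F_N`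
  (a covering map has zero-free derivative, and `|F_N′(0)| ≥ 1` by Schwarz's lemma applied to the
  lift of the inclusion `D(0,1) ⊂ ℂ ∖ μ_N`).

What is NOT here: the conformal radius `|F_N′(0)| = 16^{1/N}(1 + ζ(3)/(2N³) + …)` (CDT Theorem 5.1.4 /
arXiv Theorem 34, Kraus–Roth), the other analytic input `(radius)` of CDT Proposition 3.0.1.

## References
* [CalegariDimitrovTang2025] F. Calegari, V. Dimitrov, Y. Tang, J. Amer. Math. Soc. 38 (2025),
  Theorem 6.0.1, Lemma 5.3.5, displays (6.7)–(6.12); arXiv:2109.09040 §6.2.4.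
* [Conway1978] J. B. Conway, *Functions of One Complex Variable I*, GTM 11, Ch. XII Thm. 2.1
  (Schottky).
-/

noncomputable section

open Set Metric Filter Real
open scoped Topology

namespace Literature.Analysis.Complex

open _root_.Complex

/-! ### 1. A root of unity in the left half-plane -/

/-- For `N ≥ 2` the `N`-th root of unity `e^{2πi ⌊N/2⌋/N}` has real part `≤ −1/2` (its argument
`2π⌊N/2⌋/N` lies in `[2π/3, π]`). [folklore] -/
private theorem exists_pow_eq_one_re_le {N : ℕ} (hN : 2 ≤ N) :
    ∃ b : ℂ, b ^ N = 1 ∧ b.re ≤ -1 / 2 := by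
  set k : ℕ := N / 2 with hk
  have hk2 : 2 * k ≤ N := by omega
  have hk3 : N ≤ 3 * k := by omega
  have hN0 : (N : ℂ) ≠ 0 := by exact_mod_cast (show N ≠ 0 by omega)
  set θ : ℝ := 2 * π * k / N with hθ
  refine ⟨Complex.exp (θ * I), ?_, ?_⟩
  · rw [← Complex.exp_nat_mul]
    have : (N : ℂ) * (θ * I) = (k : ℕ) * (2 * π * I) := by
      rw [hθ]; push_cast; field_simp
    rw [this, Complex.exp_nat_mul_two_pi_mul_I]
  · rw [Complex.exp_ofReal_mul_I_re]
    have hNpos : (0 : ℝ) < N := by positivity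
    have hθlo : 2 * π / 3 ≤ θ := by
      rw [hθ, le_div_iff₀ hNpos]
      have : (N : ℝ) ≤ 3 * k := by exact_mod_cast hk3
      nlinarith [Real.pi_pos]
    have hθhi : θ ≤ π := by
      rw [hθ, div_le_iff₀ hNpos]
      have : 2 * (k : ℝ) ≤ N := by exact_mod_cast hk2
      nlinarith [Real.pi_pos]
    have hcos : Real.cos θ ≤ Real.cos (2 * π / 3) :=
      Real.cos_le_cos_of_nonneg_of_le_pi (by positivity) hθhi hθlo
    have h23 : Real.cos (2 * π / 3) = -1 / 2 := by
      have : 2 * π / 3 = π - π / 3 := by ring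
      rw [this, Real.cos_pi_sub, Real.cos_pi_div_three]; ring
    linarith

/-! ### 2. The auxiliary map `g = (F − 1)/(b − 1)` -/

/-- Norm facts for a point `b` of the unit circle with `Re b ≤ −1/2`: `‖1 + b‖ ≤ 1` and
`3/2 ≤ ‖b − 1‖`. [folklore] -/
private theorem norm_one_add_le_and_le_norm_sub_one {b : ℂ} (hb : ‖b‖ = 1) (hre : b.re ≤ -1 / 2) :
    ‖1 + b‖ ≤ 1 ∧ 3 / 2 ≤ ‖b - 1‖ := by
  have hsq : b.re * b.re + b.im * b.im = 1 := by
    have := Complex.sq_norm b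
    rw [hb, one_pow, Complex.normSq_apply] at this
    linarith
  constructor
  · have h : ‖1 + b‖ ^ 2 ≤ 1 := by
      rw [Complex.sq_norm, Complex.normSq_apply]
      simp only [add_re, one_re, add_im, one_im, zero_add]
      nlinarith
    exact (pow_le_one_iff_of_nonneg (norm_nonneg _) two_ne_zero).1 h
  · have h : (3 / 2 : ℝ) ^ 2 ≤ ‖b - 1‖ ^ 2 := by
      rw [Complex.sq_norm, Complex.normSq_apply]
      simp only [sub_re, one_re, sub_im, one_im, sub_zero]
      nlinarith
    exact le_of_pow_le_pow_left₀ two_ne_zero (norm_nonneg _) h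

/-- The compact disc `|u − 1/2| ≤ 1/3` misses `0` and `1`. [folklore] -/
private theorem ne_zero_and_ne_one_of_mem_closedBall_half {u : ℂ}
    (hu : u ∈ closedBall ((1 : ℂ) / 2) (1 / 3)) : u ≠ 0 ∧ u ≠ 1 := by
  rw [mem_closedBall, dist_eq_norm] at hu
  have h2 : ‖((1 : ℂ) / 2)‖ = 1 / 2 := by simp
  constructor
  · rintro rfl
    rw [zero_sub, norm_neg, h2] at hu
    norm_num at hu
  · rintro rfl
    have : (1 : ℂ) - 1 / 2 = 1 / 2 := by ring
    rw [this, h2] at hu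
    norm_num at hu

/-- **The auxiliary map.** For `F` holomorphic on the disc with `F 0 = 0` omitting the `N`-th roots of
unity, and `b` with `bᴺ = 1`, `Re b ≤ −1/2`: `g = (F − 1)/(b − 1)` is holomorphic on the disc, omits
`0` and `1`, has `g 0 = 1/(1 − b)` in the disc `|u − 1/2| ≤ 1/3`, and `‖F z‖ ≤ 1 + 2‖g z‖`.
[cite: CalegariDimitrovTang2025, §6.2.4] -/
theorem auxiliary_map_of_omitting_rootsOfUnity {F : ℂ → ℂ} {N : ℕ} (hN : 2 ≤ N)
    (hF : DifferentiableOn ℂ F (ball (0 : ℂ) 1)) (hF0 : F 0 = 0)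
    (hFN : ∀ z ∈ ball (0 : ℂ) 1, F z ^ N ≠ 1) {b : ℂ} (hbN : b ^ N = 1) (hbre : b.re ≤ -1 / 2) :
    DifferentiableOn ℂ (fun z ↦ (F z - 1) / (b - 1)) (ball (0 : ℂ) 1) ∧
      (∀ z ∈ ball (0 : ℂ) 1, (F z - 1) / (b - 1) ≠ 0 ∧ (F z - 1) / (b - 1) ≠ 1) ∧
      (F 0 - 1) / (b - 1) ∈ closedBall ((1 : ℂ) / 2) (1 / 3) ∧
      ∀ z : ℂ, ‖F z‖ ≤ 1 + 2 * ‖(F z - 1) / (b - 1)‖ := by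
  have hN0 : N ≠ 0 := by omega
  have hb1 : ‖b‖ = 1 := by
    have h := congrArg norm hbN
    rw [norm_pow, norm_one] at h
    exact (pow_eq_one_iff_of_nonneg (norm_nonneg b) hN0).1 h
  obtain ⟨hplus, hminus⟩ := norm_one_add_le_and_le_norm_sub_one hb1 hbre
  have hbne : b - 1 ≠ 0 := by
    intro h; rw [h, norm_zero] at hminus; norm_num at hminus
  refine ⟨?_, ?_, ?_, ?_⟩
  · exact (hF.sub (differentiableOn_const _)).div_const _
  · intro z hz
    constructor
    · rw [div_ne_zero_iff]
      refine ⟨sub_ne_zero.2 fun h ↦ hFN z hz ?_, hbne⟩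
      rw [h, one_pow]
    · intro h
      rw [div_eq_one_iff_eq hbne, sub_left_inj] at h
      exact hFN z hz (by rw [h, hbN])
  · rw [mem_closedBall, dist_eq_norm, hF0, zero_sub]
    have : -1 / (b - 1) - (1 : ℂ) / 2 = -(1 + b) / (2 * (b - 1)) := by
      field_simp; ring
    rw [this, norm_div, norm_neg, norm_mul, Complex.norm_two]
    rw [div_le_iff₀ (by positivity)]
    nlinarith [norm_nonneg (1 + b)]
  · intro z
    have hFz : F z = 1 + (b - 1) * ((F z - 1) / (b - 1)) := by
      rw [mul_div_cancel₀ (F z - 1) hbne]; ring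
    have hb2 : ‖b - 1‖ ≤ 2 := by
      calc ‖b - 1‖ ≤ ‖b‖ + ‖(1 : ℂ)‖ := norm_sub_le _ _
        _ = 2 := by rw [hb1, norm_one]; norm_num
    calc ‖F z‖ = ‖1 + (b - 1) * ((F z - 1) / (b - 1))‖ := by rw [← hFz]
      _ ≤ ‖(1 : ℂ)‖ + ‖(b - 1) * ((F z - 1) / (b - 1))‖ := norm_add_le _ _
      _ = 1 + ‖b - 1‖ * ‖(F z - 1) / (b - 1)‖ := by rw [norm_one, norm_mul]
      _ ≤ 1 + 2 * ‖(F z - 1) / (b - 1)‖ := by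
          gcongr

/-! ### 3. The `log⁺ log⁺` bound (the role of CDT Lemma 5.3.5) -/

/-- **`log⁺ log⁺ |F| ≤ log⁺ A + n·log(1/(1−r))` on `|z| = (1+r)/2`**, with ABSOLUTE `A, n`, for
every disc map `F` omitting the `N`-th roots of unity with `F(0) = 0` (`N ≥ 2`): the substitute for
CDT's Lemma 5.3.5, from Schottky's theorem with a polynomial rate.
[cite: CalegariDimitrovTang2025, Lemma 5.3.5] -/
theorem exists_posLog_posLog_le_of_omitting_rootsOfUnity :
    ∃ (A : ℝ) (n : ℕ), ∀ (N : ℕ), 2 ≤ N → ∀ (r : ℝ), 0 < r → r < 1 → ∀ F : ℂ → ℂ,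
      DifferentiableOn ℂ F (ball (0 : ℂ) 1) → F 0 = 0 → (∀ z ∈ ball (0 : ℂ) 1, F z ^ N ≠ 1) →
      ∀ z : ℂ, ‖z‖ = (1 + r) / 2 →
        log⁺ (log⁺ ‖F z‖) ≤ log⁺ A + n * Real.log (1 / (1 - r)) := by
  obtain ⟨C, n, hC, hS⟩ := exists_log_norm_le_of_mapsTo_compl_zero_one_of_isCompact
    (isCompact_closedBall ((1 : ℂ) / 2) (1 / 3)) (fun u hu ↦ ne_zero_and_ne_one_of_mem_closedBall_half hu)
  refine ⟨2 * Real.log 2 + C * 2 ^ n, n, fun N hN r hr hr1 F hF hF0 hFN z hz ↦ ?_⟩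
  obtain ⟨b, hbN, hbre⟩ := exists_pow_eq_one_re_le hN
  obtain ⟨hgd, hg01, hg0, hFg⟩ := auxiliary_map_of_omitting_rootsOfUnity hN hF hF0 hFN hbN hbre
  set g : ℂ → ℂ := fun z ↦ (F z - 1) / (b - 1) with hg
  have hz1 : z ∈ ball (0 : ℂ) 1 := by
    rw [mem_ball_zero_iff, hz]; linarith
  have h1r : 0 < 1 - r := by linarith
  -- Schottky for `g`
  have hSg : Real.log ‖g z‖ ≤ C / (1 - ‖z‖) ^ n := hS g hgd hg01 hg0 z hz1
  have hden : (1 - ‖z‖) = (1 - r) / 2 := by rw [hz]; ring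
  rw [hden, div_pow, div_div_eq_mul_div] at hSg
  -- `hSg : log ‖g z‖ ≤ C * 2 ^ n / (1 - r) ^ n`
  set D : ℝ := C * 2 ^ n / (1 - r) ^ n with hD
  have hDnn : 0 ≤ D := by positivity
  have hpow1 : (1 - r) ^ n ≤ 1 := pow_le_one₀ h1r.le (by linarith)
  have hpowpos : 0 < (1 - r) ^ n := pow_pos h1r n
  -- `log⁺ ‖g z‖ ≤ D`
  have hpg : log⁺ ‖g z‖ ≤ D := by
    rw [Real.posLog_apply]
    exact max_le hDnn hSg
  -- `log⁺ ‖F z‖ ≤ 2 log 2 + D`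
  have hpF : log⁺ ‖F z‖ ≤ 2 * Real.log 2 + D := by
    have h2 : log⁺ (2 : ℝ) = Real.log 2 := Real.posLog_eq_log (by norm_num)
    calc log⁺ ‖F z‖ ≤ log⁺ (1 + 2 * ‖g z‖) :=
          Real.posLog_le_posLog (norm_nonneg _) (hFg z)
      _ ≤ Real.log 2 + log⁺ (1 : ℝ) + log⁺ (2 * ‖g z‖) := Real.posLog_add
      _ ≤ Real.log 2 + 0 + (log⁺ (2 : ℝ) + log⁺ ‖g z‖) := by
          gcongr
          · simp [Real.posLog_apply]
          · exact Real.posLog_mul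
      _ ≤ 2 * Real.log 2 + D := by rw [h2]; linarith
  -- `2 log 2 + D ≤ A / (1 - r) ^ n` with `A = 2 log 2 + C 2^n`
  set A : ℝ := 2 * Real.log 2 + C * 2 ^ n with hA
  have hA0 : 0 ≤ A := by positivity
  have hpF' : log⁺ ‖F z‖ ≤ A * ((1 - r) ^ n)⁻¹ := by
    have h1 : 2 * Real.log 2 ≤ 2 * Real.log 2 / (1 - r) ^ n := by
      rw [le_div_iff₀ hpowpos]
      have : 0 ≤ 2 * Real.log 2 := by positivity
      nlinarith
    calc log⁺ ‖F z‖ ≤ 2 * Real.log 2 + D := hpF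
      _ ≤ 2 * Real.log 2 / (1 - r) ^ n + C * 2 ^ n / (1 - r) ^ n := by rw [hD]; linarith
      _ = A * ((1 - r) ^ n)⁻¹ := by rw [hA]; ring
  -- take `log⁺` once more
  have hinv1 : 1 ≤ ((1 - r) ^ n)⁻¹ := one_le_inv_iff₀.2 ⟨hpowpos, hpow1⟩
  calc log⁺ (log⁺ ‖F z‖) ≤ log⁺ (A * ((1 - r) ^ n)⁻¹) :=
        Real.posLog_le_posLog Real.posLog_nonneg hpF'
    _ ≤ log⁺ A + log⁺ (((1 - r) ^ n)⁻¹) := Real.posLog_mul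
    _ = log⁺ A + n * Real.log (1 / (1 - r)) := by
        rw [Real.posLog_eq_log (x := ((1 - r) ^ n)⁻¹) (by rw [abs_of_pos (by positivity)]; exact hinv1),
          Real.log_inv, Real.log_pow, one_div, Real.log_inv]
        ring

/-! ### 4. CDT (6.12) unconditionally, and Theorem 6.0.1 -/

/-- **CDT display (6.12), unconditionally.** There are absolute constants `C₁ ≥ 0`, `C₂` such that for
every `N ≥ 2`, every `0 < r < 1` and every `F` holomorphic on the unit disc with `F(0) = 0`,
`|F′(0)| ≥ 1`, `F′` zero-free and `F(z)ᴺ ≠ 1` on the disc,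
`(N − 1) · ∫_{|z|=r} log⁺|F| μ_Haar ≤ C₁ log(1/(1 − r)) + log N + C₂`.
[cite: CalegariDimitrovTang2025, Theorem 6.0.1, display (6.12)] -/
theorem exists_uniform_mean_growth_of_omitting_rootsOfUnity :
    ∃ C₁ C₂ : ℝ, 0 ≤ C₁ ∧ ∀ (N : ℕ), 2 ≤ N → ∀ (r : ℝ), 0 < r → r < 1 → ∀ F : ℂ → ℂ,
      DifferentiableOn ℂ F (ball (0 : ℂ) 1) → F 0 = 0 → 1 ≤ ‖deriv F 0‖ →
      (∀ z ∈ ball (0 : ℂ) 1, deriv F z ≠ 0) → (∀ z ∈ ball (0 : ℂ) 1, F z ^ N ≠ 1) →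
      (N - 1 : ℝ) * circleAverage (fun z ↦ log⁺ ‖F z‖) 0 r ≤
        C₁ * Real.log (1 / (1 - r)) + Real.log N + C₂ := by
  obtain ⟨A, n, hM⟩ := exists_posLog_posLog_le_of_omitting_rootsOfUnity
  refine ⟨2 + 2 * n, 2 * log⁺ A + 15 * Real.log 2 + 2 * Real.exp (-1), by positivity,
    fun N hN r hr hr1 F hF hF0 hF'0 hF' hFN ↦ ?_⟩
  have h := uniform_growth_of_omitting_rootsOfUnity hN hr hr1 hF hF0 hF'0 hF' hFN
    (M := log⁺ A + n * Real.log (1 / (1 - r))) (hM N hN r hr hr1 F hF hF0 hFN)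
  calc (N - 1 : ℝ) * circleAverage (fun z ↦ log⁺ ‖F z‖) 0 r
      ≤ 2 * Real.log (1 / (1 - r)) + Real.log N + 2 * (log⁺ A + n * Real.log (1 / (1 - r))) +
          15 * Real.log 2 + 2 * Real.exp (-1) := h
    _ = (2 + 2 * n) * Real.log (1 / (1 - r)) + Real.log N +
          (2 * log⁺ A + 15 * Real.log 2 + 2 * Real.exp (-1)) := by ring

/-- ★ **CDT Theorem 6.0.1 (uniform mean growth near the boundary), unconditionally and for every disc
map omitting `μ_N`.** For every `B > 0` there is `C_B` such that for all `N ≥ 2` with `N³ > B` and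
every `F` holomorphic on the unit disc with `F(0) = 0`, `|F′(0)| ≥ 1`, `F′` zero-free and
`F(z)ᴺ ≠ 1` on the disc — in particular the universal covering map `F_N : D(0,1) → ℂ ∖ μ_N` —
`∫_{|z| = 1 − B N⁻³} log⁺ |F| μ_Haar ≤ C_B · (log N)/N`.
[cite: CalegariDimitrovTang2025, Theorem 6.0.1] -/
theorem exists_circleAverage_posLog_le_of_omitting_rootsOfUnity {B : ℝ} (hB : 0 < B) :
    ∃ C : ℝ, ∀ (N : ℕ), 2 ≤ N → B < (N : ℝ) ^ 3 → ∀ F : ℂ → ℂ,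
      DifferentiableOn ℂ F (ball (0 : ℂ) 1) → F 0 = 0 → 1 ≤ ‖deriv F 0‖ →
      (∀ z ∈ ball (0 : ℂ) 1, deriv F z ≠ 0) → (∀ z ∈ ball (0 : ℂ) 1, F z ^ N ≠ 1) →
      circleAverage (fun z ↦ log⁺ ‖F z‖) 0 (1 - B / (N : ℝ) ^ 3) ≤ C * Real.log N / N := by
  obtain ⟨C₁, C₂, hC₁, h⟩ := exists_uniform_mean_growth_of_omitting_rootsOfUnity
  -- the constant
  set C' : ℝ := 3 * C₁ + 1 + (C₁ * |Real.log B| + |C₂|) / Real.log 2 with hC'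
  have hlog2 : 0 < Real.log 2 := Real.log_pos (by norm_num)
  have hC'0 : 0 ≤ C' := by positivity
  refine ⟨2 * C', fun N hN hBN F hF hF0 hF'0 hF' hFN ↦ ?_⟩
  have hN2 : (2 : ℝ) ≤ N := by exact_mod_cast hN
  have hNpos : (0 : ℝ) < N := by linarith
  have hN3 : (0 : ℝ) < (N : ℝ) ^ 3 := by positivity
  set r : ℝ := 1 - B / (N : ℝ) ^ 3 with hr
  have hr0 : 0 < r := by
    rw [hr, sub_pos, div_lt_one hN3]; exact hBN
  have hr1 : r < 1 := by
    rw [hr]; have : 0 < B / (N : ℝ) ^ 3 := by positivity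
    linarith
  have hmain := h N hN r hr0 hr1 F hF hF0 hF'0 hF' hFN
  have hlogr : Real.log (1 / (1 - r)) = 3 * Real.log N - Real.log B := by
    have : 1 / (1 - r) = (N : ℝ) ^ 3 / B := by rw [hr, sub_sub_cancel, one_div_div]
    rw [this, Real.log_div hN3.ne' hB.ne', Real.log_pow]; ring
  rw [hlogr] at hmain
  have hlogN : Real.log 2 ≤ Real.log N := Real.log_le_log (by norm_num) hN2
  have hlogNpos : 0 < Real.log N := lt_of_lt_of_le hlog2 hlogN
  -- `(N - 1) m ≤ C' log N`
  have hbound : (N - 1 : ℝ) * circleAverage (fun z ↦ log⁺ ‖F z‖) 0 r ≤ C' * Real.log N := by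
    have h1 : C₁ * (3 * Real.log N - Real.log B) + Real.log N + C₂ ≤
        (3 * C₁ + 1) * Real.log N + (C₁ * |Real.log B| + |C₂|) := by
      have ha : -(C₁ * Real.log B) ≤ C₁ * |Real.log B| := by
        have := neg_abs_le (Real.log B)
        nlinarith [abs_nonneg (Real.log B)]
      have hb : C₂ ≤ |C₂| := le_abs_self _
      nlinarith
    have h2 : (C₁ * |Real.log B| + |C₂|) ≤ (C₁ * |Real.log B| + |C₂|) / Real.log 2 * Real.log N := by
      rw [div_mul_eq_mul_div, le_div_iff₀ hlog2]
      have : 0 ≤ C₁ * |Real.log B| + |C₂| := by positivity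
      nlinarith
    calc (N - 1 : ℝ) * circleAverage (fun z ↦ log⁺ ‖F z‖) 0 r
        ≤ C₁ * (3 * Real.log N - Real.log B) + Real.log N + C₂ := hmain
      _ ≤ (3 * C₁ + 1) * Real.log N + (C₁ * |Real.log B| + |C₂|) / Real.log 2 * Real.log N := by
          linarith
      _ = C' * Real.log N := by rw [hC']; ring
  -- divide by `N - 1 ≥ N/2`
  have hN1 : (0 : ℝ) < N - 1 := by linarith
  have hm : circleAverage (fun z ↦ log⁺ ‖F z‖) 0 r ≤ C' * Real.log N / (N - 1) := by
    rw [le_div_iff₀ hN1]; linarith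
  calc circleAverage (fun z ↦ log⁺ ‖F z‖) 0 r ≤ C' * Real.log N / (N - 1) := hm
    _ ≤ 2 * C' * Real.log N / N := by
        rw [div_le_div_iff₀ hN1 hNpos]
        have : 0 ≤ C' * Real.log N := by positivity
        nlinarith

end Literature.Analysis.Complex

end
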